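import Mathlib
import Literature.Probability.LatticeModels.GKSInequalities
import HarnessLib

/-!
# Crux `PrecisionLaplacian.InverseMFerromagnet` (stmt-CriticalPhenomena-4798), line `Sketch` —
# auxiliary lemmas (part 1) for stub `stub_level_three` (level three of the partial-covariance ladder)

THEOREM-ONLY helper file (no definitions).  Generic tools used by the level-three stub:

* linearity / positivity / spin-flip symmetry / constant-shift invariance of the Gibbs expectation
  `gksExpect`;
* cylinder indicators of sign patterns `s : ↥S → ℤˣ`,
  `1_s(ω) = ∏_{p ∈ S} (1 + s_p σ_p(ω))/2 = [ω|_S = s]`, the moment identity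
  `⟨h(ω) φ(ω|_S)⟩ = ∑_s ⟨h 1_s⟩ φ(s)`, positivity `⟨1_s⟩ > 0` and flip symmetry of `⟨1_s⟩`, `⟨σ_x 1_s⟩`;
* an abstract Schur-complement inequality: for a Gram matrix `M_pq = ∑_s P_s χ_p(s) χ_q(s)` (`P ≥ 0`,
  `M` invertible) and `f = ∑_p λ^f_p χ_p + κ_f e`, `g = ∑_p λ^g_p χ_p + κ_g e` with `κ_f κ_g ≥ 0`,
  `∑_s P_s f g − u_fᵀ M⁻¹ u_g = κ_f κ_g (∑_s P_s e² − vᵀ M⁻¹ v) ≥ 0`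
  (`u_f = (∑_s P_s f χ_p)_p`, `v = (∑_s P_s e χ_p)_p`);
* the Walsh decomposition of an odd function on the cube `{±1}³`:
  `μ(s) = λ_a s_a + λ_b s_b + λ_c s_c + κ s_a s_b s_c`, `4κ = μ(+++) + μ(+−−) − μ(++−) − μ(+−+)`.

The registered representative is `helper_l3_aux` (the cylinder moment identity `∑_s 1_s(ω) φ(s) = φ(ω|_S)`).
-/

namespace Summit.CriticalPhenomena.Ising3DConformalLimit.Cruxes.InverseMFerromagnet.PartialCovarianceLadder

open Literature.Probability.LatticeModels Finset Matrix

noncomputable section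

variable {ι Λ : Type*} [Fintype Λ] [DecidableEq Λ]

/-! ## Linearity, positivity, symmetries of `gksExpect` -/

/-- Linearity of `⟨·⟩` over finite sums. [folklore] -/
theorem l3_gksExpect_finset_sum {β : Type*} (s : Finset ι) (K : ι → ℝ) (C : ι → Finset Λ)
    (T : Finset β) (g : β → SpinConfig Λ → ℝ) :
    gksExpect s K C (fun ω => ∑ b ∈ T, g b ω) = ∑ b ∈ T, gksExpect s K C (g b) := by
  simp only [gksExpect, gksSum, Finset.sum_mul, Finset.sum_div]
  rw [Finset.sum_comm]

/-- Homogeneity of `⟨·⟩`. [folklore] -/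
theorem l3_gksExpect_const_mul (s : Finset ι) (K : ι → ℝ) (C : ι → Finset Λ) (a : ℝ)
    (f : SpinConfig Λ → ℝ) :
    gksExpect s K C (fun ω => a * f ω) = a * gksExpect s K C f := by
  simp only [gksExpect, gksSum_smul, mul_div_assoc]

/-- If two Hamiltonians differ by a constant, their Gibbs expectations agree. [folklore] -/
theorem l3_gksExpect_eq_of_hamiltonian_eq_add_const {ι' : Type*} (s : Finset ι) (K : ι → ℝ)
    (C : ι → Finset Λ) (s' : Finset ι') (K' : ι' → ℝ) (C' : ι' → Finset Λ) (c : ℝ)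
    (hH : ∀ ω, gksHamiltonian s K C ω = gksHamiltonian s' K' C' ω + c) (f : SpinConfig Λ → ℝ) :
    gksExpect s K C f = gksExpect s' K' C' f := by
  simp only [gksExpect, gksSum, gksWeight, hH, Real.exp_add, ← mul_assoc, ← Finset.sum_mul]
  rw [mul_div_mul_right _ _ (Real.exp_pos c).ne']

omit [Fintype Λ] [DecidableEq Λ] in
/-- `σ_x(−ω) = −σ_x(ω)`. [folklore] -/
theorem l3_spinAt_neg (x : Λ) (ω : SpinConfig Λ) : spinAt x (-ω) = -spinAt x ω := by
  simp [spinAt, Units.val_neg]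

/-- Spin-flip symmetry of an even (pair) interaction: `⟨f ∘ (−)⟩ = ⟨f⟩` when all `|C i| = 2`. [folklore] -/
theorem l3_gksExpect_comp_neg (s : Finset ι) (K : ι → ℝ) (C : ι → Finset Λ)
    (hC : ∀ i, (C i).card = 2) (f : SpinConfig Λ → ℝ) :
    gksExpect s K C (fun ω => f (-ω)) = gksExpect s K C f := by
  have hw : ∀ ω, gksWeight s K C (-ω) = gksWeight s K C ω := by
    intro ω
    simp only [gksWeight, gksHamiltonian, spinProduct_neg, hC]
    norm_num
  simp only [gksExpect, gksSum]
  congr 1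
  calc ∑ ω, f (-ω) * gksWeight s K C ω = ∑ ω, f (-ω) * gksWeight s K C (-ω) := by
        simp only [hw]
    _ = ∑ ω, f ω * gksWeight s K C ω :=
        Equiv.sum_comp (Equiv.neg (SpinConfig Λ)) (fun ω => f ω * gksWeight s K C ω)

/-! ## Cylinder indicators of sign patterns -/

omit [Fintype Λ] [DecidableEq Λ] in
/-- The cylinder indicator: `∏_{p ∈ S} (1 + s_p σ_p(ω))/2 = [ω|_S = s]`. [folklore] -/
theorem l3_cyl_eq_ite (S : Finset Λ) (s : ↥S → ℤˣ) (ω : SpinConfig Λ) :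
    (∏ p : ↥S, (1 + (((s p : ℤˣ) : ℤ) : ℝ) * spinAt p.1 ω) / 2)
      = if s = (fun p : ↥S => ω p.1) then 1 else 0 := by
  split_ifs with h
  · refine Finset.prod_eq_one fun p _ => ?_
    rw [h]
    simp only [spinAt]
    rcases Int.units_eq_one_or (ω p.1) with h1 | h1 <;> simp [h1]
  · obtain ⟨p, hp⟩ : ∃ p : ↥S, s p ≠ ω p.1 := Function.ne_iff.mp h
    refine Finset.prod_eq_zero (Finset.mem_univ p) ?_
    have h2 : (((s p : ℤˣ) : ℤ) : ℝ) * spinAt p.1 ω = -1 := by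
      simp only [spinAt]
      rcases Int.units_eq_one_or (s p) with h1 | h1 <;>
        rcases Int.units_eq_one_or (ω p.1) with h3 | h3 <;> simp_all
    rw [h2]
    norm_num

omit [Fintype Λ] in
/-- `∑_s 1_s(ω) φ(s) = φ(ω|_S)`. [folklore] -/
theorem l3_sum_cyl_mul (S : Finset Λ) (φ : (↥S → ℤˣ) → ℝ) (ω : SpinConfig Λ) :
    ∑ s : ↥S → ℤˣ, (∏ p : ↥S, (1 + (((s p : ℤˣ) : ℤ) : ℝ) * spinAt p.1 ω) / 2) * φ s
      = φ (fun p : ↥S => ω p.1) := by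
  simp only [l3_cyl_eq_ite, ite_mul, one_mul, zero_mul, Finset.sum_ite_eq', Finset.mem_univ,
    if_true]

/-- Moment identity `⟨h(ω) φ(ω|_S)⟩ = ∑_s ⟨h 1_s⟩ φ(s)`. [folklore] -/
theorem l3_gksExpect_mul_restrict (s₀ : Finset ι) (K : ι → ℝ) (C : ι → Finset Λ) (S : Finset Λ)
    (h : SpinConfig Λ → ℝ) (φ : (↥S → ℤˣ) → ℝ) :
    gksExpect s₀ K C (fun ω => h ω * φ (fun p : ↥S => ω p.1))
      = ∑ s : ↥S → ℤˣ, gksExpect s₀ K C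
          (fun ω => h ω * ∏ p : ↥S, (1 + (((s p : ℤˣ) : ℤ) : ℝ) * spinAt p.1 ω) / 2) * φ s := by
  have hfun : (fun ω => h ω * φ (fun p : ↥S => ω p.1)) = fun ω => ∑ s : ↥S → ℤˣ,
      φ s * (h ω * ∏ p : ↥S, (1 + (((s p : ℤˣ) : ℤ) : ℝ) * spinAt p.1 ω) / 2) := by
    funext ω
    rw [← l3_sum_cyl_mul S φ ω, Finset.mul_sum]
    exact Finset.sum_congr rfl fun s _ => by ring
  rw [hfun, l3_gksExpect_finset_sum]
  exact Finset.sum_congr rfl fun s _ => by rw [l3_gksExpect_const_mul, mul_comm]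

/-- `⟨1_s⟩ > 0`. [folklore] -/
theorem l3_gksExpect_cyl_pos (s₀ : Finset ι) (K : ι → ℝ) (C : ι → Finset Λ) (S : Finset Λ)
    (s : ↥S → ℤˣ) :
    0 < gksExpect s₀ K C (fun ω => ∏ p : ↥S, (1 + (((s p : ℤˣ) : ℤ) : ℝ) * spinAt p.1 ω) / 2) := by
  refine div_pos ?_ (gksSum_one_pos s₀ K C)
  simp only [gksSum]
  set ω₀ : SpinConfig Λ := fun z => if hz : z ∈ S then s ⟨z, hz⟩ else 1 with hω₀
  have hs : s = fun p : ↥S => ω₀ p.1 := by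
    funext p
    simp [hω₀, p.2]
  refine Finset.sum_pos' (fun ω _ => mul_nonneg ?_ (gksWeight_pos s₀ K C ω).le)
    ⟨ω₀, Finset.mem_univ _, ?_⟩
  · rw [l3_cyl_eq_ite]
    split_ifs <;> norm_num
  · rw [l3_cyl_eq_ite, if_pos hs, one_mul]
    exact gksWeight_pos s₀ K C ω₀

omit [Fintype Λ] [DecidableEq Λ] in
/-- `1_{−s}(ω) = 1_s(−ω)`. [folklore] -/
theorem l3_cyl_neg (S : Finset Λ) (s : ↥S → ℤˣ) (ω : SpinConfig Λ) :
    (∏ p : ↥S, (1 + ((((-s) p : ℤˣ) : ℤ) : ℝ) * spinAt p.1 ω) / 2)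
      = ∏ p : ↥S, (1 + (((s p : ℤˣ) : ℤ) : ℝ) * spinAt p.1 (-ω)) / 2 := by
  refine Finset.prod_congr rfl fun p _ => ?_
  simp only [Pi.neg_apply, Units.val_neg, Int.cast_neg, l3_spinAt_neg]
  ring

/-- Flip symmetry of cylinder probabilities: `⟨1_{−s}⟩ = ⟨1_s⟩` (pair interactions). [folklore] -/
theorem l3_gksExpect_cyl_neg (s₀ : Finset ι) (K : ι → ℝ) (C : ι → Finset Λ)
    (hC : ∀ i, (C i).card = 2) (S : Finset Λ) (s : ↥S → ℤˣ) :
    gksExpect s₀ K C (fun ω => ∏ p : ↥S, (1 + ((((-s) p : ℤˣ) : ℤ) : ℝ) * spinAt p.1 ω) / 2)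
      = gksExpect s₀ K C (fun ω => ∏ p : ↥S, (1 + (((s p : ℤˣ) : ℤ) : ℝ) * spinAt p.1 ω) / 2) := by
  simp only [l3_cyl_neg]
  exact l3_gksExpect_comp_neg s₀ K C hC
    (fun ω => ∏ p : ↥S, (1 + (((s p : ℤˣ) : ℤ) : ℝ) * spinAt p.1 ω) / 2)

/-- Flip antisymmetry of `⟨σ_x 1_s⟩`: `⟨σ_x 1_{−s}⟩ = −⟨σ_x 1_s⟩` (pair interactions). [folklore] -/
theorem l3_gksExpect_spin_cyl_neg (s₀ : Finset ι) (K : ι → ℝ) (C : ι → Finset Λ)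
    (hC : ∀ i, (C i).card = 2) (S : Finset Λ) (x : Λ) (s : ↥S → ℤˣ) :
    gksExpect s₀ K C
        (fun ω => spinAt x ω * ∏ p : ↥S, (1 + ((((-s) p : ℤˣ) : ℤ) : ℝ) * spinAt p.1 ω) / 2)
      = -gksExpect s₀ K C
        (fun ω => spinAt x ω * ∏ p : ↥S, (1 + (((s p : ℤˣ) : ℤ) : ℝ) * spinAt p.1 ω) / 2) := by
  simp only [l3_cyl_neg]
  have hfun : (fun ω => spinAt x ω * ∏ p : ↥S, (1 + (((s p : ℤˣ) : ℤ) : ℝ) * spinAt p.1 (-ω)) / 2)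
      = fun ω => (-1) * (fun ω' => spinAt x ω'
          * ∏ p : ↥S, (1 + (((s p : ℤˣ) : ℤ) : ℝ) * spinAt p.1 ω') / 2) (-ω) := by
    funext ω
    simp only [l3_spinAt_neg]
    ring
  rw [hfun, l3_gksExpect_const_mul]
  have h2 := l3_gksExpect_comp_neg s₀ K C hC
    (fun ω' => spinAt x ω' * ∏ p : ↥S, (1 + (((s p : ℤˣ) : ℤ) : ℝ) * spinAt p.1 ω') / 2)
  rw [h2]
  ring

/-! ## Abstract Schur-complement inequality for Gram matrices -/

/-- `∑_s w_s (∑_p l_p χ_p(s)) = ∑_p l_p ∑_s w_s χ_p(s)`. [folklore] -/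
theorem l3_sum_mul_sum_swap {α J : Type*} [Fintype α] [Fintype J] (w : α → ℝ) (l : J → ℝ)
    (χ : J → α → ℝ) :
    ∑ s, w s * ∑ p, l p * χ p s = ∑ p, l p * ∑ s, w s * χ p s := by
  calc ∑ s, w s * ∑ p, l p * χ p s = ∑ s, ∑ p, l p * (w s * χ p s) := by
        refine Finset.sum_congr rfl fun s _ => ?_
        rw [Finset.mul_sum]
        exact Finset.sum_congr rfl fun p _ => by ring
    _ = ∑ p, ∑ s, l p * (w s * χ p s) := Finset.sum_comm
    _ = ∑ p, l p * ∑ s, w s * χ p s := by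
        refine Finset.sum_congr rfl fun p _ => ?_
        rw [Finset.mul_sum]

/-- `∑_s w_s (∑_p l_p χ_p(s) + k e(s)) = ∑_p l_p ∑_s w_s χ_p(s) + k ∑_s w_s e(s)`. [folklore] -/
theorem l3_sum_mul_lin_add {α J : Type*} [Fintype α] [Fintype J] (w : α → ℝ) (l : J → ℝ) (k : ℝ)
    (χ : J → α → ℝ) (e : α → ℝ) :
    ∑ s, w s * (∑ p, l p * χ p s + k * e s)
      = ∑ p, l p * ∑ s, w s * χ p s + k * ∑ s, w s * e s := by
  simp only [mul_add, Finset.sum_add_distrib]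
  rw [l3_sum_mul_sum_swap]
  congr 1
  rw [Finset.mul_sum]
  exact Finset.sum_congr rfl fun s _ => by ring

/-- Residual variance: for the Gram matrix `M_pq = ∑_s P_s χ_p(s) χ_q(s)` (`P ≥ 0`, `M` invertible) and
`v_p = ∑_s P_s e(s) χ_p(s)`, `∑_s P_s e(s)² − vᵀ M⁻¹ v = ∑_s P_s (e(s) − (M⁻¹v)·χ(s))² ≥ 0`. [folklore] -/
theorem l3_gram_residual_nonneg {α J : Type*} [Fintype α] [Fintype J] [DecidableEq J]
    (P : α → ℝ) (hP : ∀ s, 0 ≤ P s) (χ : J → α → ℝ) (e : α → ℝ) (M : Matrix J J ℝ)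
    (hM : ∀ p q, M p q = ∑ s, P s * χ p s * χ q s) (hdet : IsUnit M.det) :
    0 ≤ ∑ s, P s * e s * e s
        - (fun p => ∑ s, P s * e s * χ p s) ⬝ᵥ (M⁻¹ *ᵥ fun p => ∑ s, P s * e s * χ p s) := by
  set v : J → ℝ := fun p => ∑ s, P s * e s * χ p s with hv
  set w : J → ℝ := M⁻¹ *ᵥ v with hw
  have hMw : M *ᵥ w = v := by
    rw [hw, Matrix.mulVec_mulVec, Matrix.mul_nonsing_inv M hdet, Matrix.one_mulVec]
  have hR : 0 ≤ ∑ s, P s * (e s - ∑ p, w p * χ p s) ^ 2 :=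
    Finset.sum_nonneg fun s _ => mul_nonneg (hP s) (sq_nonneg _)
  have h1 : ∑ s, P s * e s * ∑ p, w p * χ p s = w ⬝ᵥ v := by
    rw [l3_sum_mul_sum_swap]
    rfl
  have h2 : ∑ s, P s * (∑ p, w p * χ p s) * ∑ q, w q * χ q s = w ⬝ᵥ v := by
    rw [l3_sum_mul_sum_swap, ← hMw]
    refine Finset.sum_congr rfl fun q _ => ?_
    congr 1
    calc ∑ s, P s * (∑ p, w p * χ p s) * χ q s = ∑ s, (P s * χ q s) * ∑ p, w p * χ p s :=
          Finset.sum_congr rfl fun s _ => by ring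
      _ = ∑ p, w p * ∑ s, (P s * χ q s) * χ p s := l3_sum_mul_sum_swap _ _ _
      _ = (M *ᵥ w) q := by
          simp only [Matrix.mulVec, dotProduct, hM]
          exact Finset.sum_congr rfl fun p _ => by ring
  have key : ∑ s, P s * (e s - ∑ p, w p * χ p s) ^ 2 = ∑ s, P s * e s * e s - w ⬝ᵥ v := by
    have hexp : ∀ s, P s * (e s - ∑ p, w p * χ p s) ^ 2
        = P s * e s * e s - 2 * (P s * e s * ∑ p, w p * χ p s)
          + P s * (∑ p, w p * χ p s) * ∑ q, w q * χ q s := fun s => by ring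
    simp only [hexp, Finset.sum_add_distrib, Finset.sum_sub_distrib, ← Finset.mul_sum, h1, h2]
    ring
  rw [dotProduct_comm]
  linarith

/-- Abstract Schur-complement inequality: for the Gram matrix `M_pq = ∑_s P_s χ_p(s) χ_q(s)` (`P ≥ 0`,
`M` invertible), `f = ∑_p λ^f_p χ_p + κ_f e`, `g = ∑_p λ^g_p χ_p + κ_g e` with `κ_f κ_g ≥ 0`, one has
`∑_s P_s f g − u_fᵀ M⁻¹ u_g = κ_f κ_g (∑_s P_s e² − vᵀ M⁻¹ v) ≥ 0`, where `u_f = (∑_s P_s f χ_p)_p`,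
`v = (∑_s P_s e χ_p)_p` (the projection onto `span χ` kills the linear parts). [folklore] -/
theorem l3_gram_schur_nonneg {α J : Type*} [Fintype α] [Fintype J] [DecidableEq J]
    (P : α → ℝ) (hP : ∀ s, 0 ≤ P s) (χ : J → α → ℝ) (e f g : α → ℝ) (M : Matrix J J ℝ)
    (hM : ∀ p q, M p q = ∑ s, P s * χ p s * χ q s) (hdet : IsUnit M.det)
    (lf lg : J → ℝ) (kf kg : ℝ)
    (hf : ∀ s, f s = ∑ p, lf p * χ p s + kf * e s) (hg : ∀ s, g s = ∑ p, lg p * χ p s + kg * e s)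
    (hk : 0 ≤ kf * kg) :
    0 ≤ ∑ s, P s * f s * g s
        - ∑ p, ∑ q, (∑ s, P s * f s * χ p s) * M⁻¹ p q * (∑ s, P s * g s * χ q s) := by
  have hMt : Mᵀ = M := by
    ext p q
    simp only [Matrix.transpose_apply, hM]
    exact Finset.sum_congr rfl fun s _ => by ring
  set v : J → ℝ := fun p => ∑ s, P s * e s * χ p s with hv
  set qee : ℝ := ∑ s, P s * e s * e s with hqee
  set uf : J → ℝ := fun p => ∑ s, P s * f s * χ p s with huf
  set ug : J → ℝ := fun p => ∑ s, P s * g s * χ p s with hug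
  -- `u_h = M λ^h + κ_h v`
  have hu : ∀ (h : α → ℝ) (l : J → ℝ) (k : ℝ), (∀ s, h s = ∑ p, l p * χ p s + k * e s) →
      (fun p => ∑ s, P s * h s * χ p s) = M *ᵥ l + k • v := by
    intro h l k hh
    funext p
    simp only [Pi.add_apply, Pi.smul_apply, smul_eq_mul, Matrix.mulVec, dotProduct, hv]
    calc ∑ s, P s * h s * χ p s = ∑ s, (P s * χ p s) * (∑ q, l q * χ q s + k * e s) :=
          Finset.sum_congr rfl fun s _ => by rw [hh]; ring
      _ = ∑ q, l q * ∑ s, (P s * χ p s) * χ q s + k * ∑ s, (P s * χ p s) * e s :=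
          l3_sum_mul_lin_add _ _ _ _ _
      _ = ∑ q, M p q * l q + k * ∑ s, P s * e s * χ p s := by
          congr 1
          · exact Finset.sum_congr rfl fun q _ => by rw [hM, mul_comm]
          · congr 1
            exact Finset.sum_congr rfl fun s _ => by ring
  have huf' : uf = M *ᵥ lf + kf • v := hu f lf kf hf
  have hug' : ug = M *ᵥ lg + kg • v := hu g lg kg hg
  -- `∑ P f g = λ^g · u_f + κ_g (λ^f · v + κ_f qee)`
  have hfg : ∑ s, P s * f s * g s = lg ⬝ᵥ uf + kg * (lf ⬝ᵥ v + kf * qee) := by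
    have hfe : ∑ s, (P s * e s) * f s = lf ⬝ᵥ v + kf * qee := by
      calc ∑ s, (P s * e s) * f s = ∑ s, (P s * e s) * (∑ p, lf p * χ p s + kf * e s) :=
            Finset.sum_congr rfl fun s _ => by rw [hf]
        _ = ∑ p, lf p * ∑ s, (P s * e s) * χ p s + kf * ∑ s, (P s * e s) * e s :=
            l3_sum_mul_lin_add _ _ _ _ _
        _ = lf ⬝ᵥ v + kf * qee := rfl
    calc ∑ s, P s * f s * g s = ∑ s, (P s * f s) * (∑ q, lg q * χ q s + kg * e s) :=
          Finset.sum_congr rfl fun s _ => by rw [hg]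
      _ = ∑ q, lg q * ∑ s, (P s * f s) * χ q s + kg * ∑ s, (P s * f s) * e s :=
          l3_sum_mul_lin_add _ _ _ _ _
      _ = lg ⬝ᵥ uf + kg * ∑ s, (P s * e s) * f s := by
          congr 2
          exact Finset.sum_congr rfl fun s _ => by ring
      _ = lg ⬝ᵥ uf + kg * (lf ⬝ᵥ v + kf * qee) := by rw [hfe]
  -- the double sum is `u_f · M⁻¹ u_g`
  have hds : ∑ p, ∑ q, (∑ s, P s * f s * χ p s) * M⁻¹ p q * (∑ s, P s * g s * χ q s)
      = uf ⬝ᵥ (M⁻¹ *ᵥ ug) := by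
    simp only [huf, hug, dotProduct, Matrix.mulVec, Finset.mul_sum, mul_assoc]
  have hMinv_ug : M⁻¹ *ᵥ ug = lg + kg • (M⁻¹ *ᵥ v) := by
    rw [hug', Matrix.mulVec_add, Matrix.mulVec_smul, Matrix.mulVec_mulVec,
      Matrix.nonsing_inv_mul M hdet, Matrix.one_mulVec]
  have hMlf_w : (M *ᵥ lf) ⬝ᵥ (M⁻¹ *ᵥ v) = lf ⬝ᵥ v := by
    rw [← Matrix.vecMul_transpose, ← Matrix.dotProduct_mulVec, hMt, Matrix.mulVec_mulVec,
      Matrix.mul_nonsing_inv M hdet, Matrix.one_mulVec]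
  have hres := l3_gram_residual_nonneg P hP χ e M hM hdet
  have hmain : ∑ s, P s * f s * g s - uf ⬝ᵥ (M⁻¹ *ᵥ ug)
      = kf * kg * (qee - v ⬝ᵥ (M⁻¹ *ᵥ v)) := by
    rw [hfg, hMinv_ug, huf']
    simp only [add_dotProduct, dotProduct_add, dotProduct_smul, smul_dotProduct, smul_eq_mul,
      hMlf_w]
    rw [dotProduct_comm lg (M *ᵥ lf), dotProduct_comm v lg]
    ring
  rw [hds, hmain]
  exact mul_nonneg hk hres

/-! ## Odd functions on the cube `{±1}³` -/

/-- Walsh decomposition of an odd function on `{±1}³`: if `μ(−s) = −μ(s)` then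
`μ(s) = λ_a s_a + λ_b s_b + λ_c s_c + κ s_a s_b s_c` with
`4κ = μ(+++) + μ(+−−) − μ(++−) − μ(+−+)`.  Here patterns `s : J → ℤˣ` are determined by their values
at `a, b, c` (`hext`), and `pat u v w` is any pattern with these values (`hpa`, `hpb`, `hpc`). [folklore] -/
theorem l3_odd_cube_decomp {J : Type*} (a b c : J) (pat : ℤˣ → ℤˣ → ℤˣ → (J → ℤˣ))
    (hpa : ∀ u v w, pat u v w a = u) (hpb : ∀ u v w, pat u v w b = v)
    (hpc : ∀ u v w, pat u v w c = w)
    (hext : ∀ s t : J → ℤˣ, s a = t a → s b = t b → s c = t c → s = t)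
    (μ : (J → ℤˣ) → ℝ) (hodd : ∀ s, μ (-s) = -μ s) :
    ∃ la lb lc : ℝ, ∀ s, μ s
      = la * (((s a : ℤˣ) : ℤ) : ℝ) + lb * (((s b : ℤˣ) : ℤ) : ℝ) + lc * (((s c : ℤˣ) : ℤ) : ℝ)
        + (μ (pat 1 1 1) + μ (pat 1 (-1) (-1)) - μ (pat 1 1 (-1)) - μ (pat 1 (-1) 1)) / 4
          * ((((s a : ℤˣ) : ℤ) : ℝ) * (((s b : ℤˣ) : ℤ) : ℝ) * (((s c : ℤˣ) : ℤ) : ℝ)) := by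
  have hneg : ∀ u v w, -(pat u v w) = pat (-u) (-v) (-w) := fun u v w =>
    hext _ _ (by rw [Pi.neg_apply, hpa, hpa]) (by rw [Pi.neg_apply, hpb, hpb])
      (by rw [Pi.neg_apply, hpc, hpc])
  have hflip : ∀ v w, μ (pat (-1) v w) = -μ (pat 1 (-v) (-w)) := by
    intro v w
    rw [← hodd, hneg, neg_neg, neg_neg]
  refine ⟨(μ (pat 1 1 1) + μ (pat 1 1 (-1)) + μ (pat 1 (-1) 1) + μ (pat 1 (-1) (-1))) / 4,
    (μ (pat 1 1 1) + μ (pat 1 1 (-1)) - μ (pat 1 (-1) 1) - μ (pat 1 (-1) (-1))) / 4,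
    (μ (pat 1 1 1) - μ (pat 1 1 (-1)) + μ (pat 1 (-1) 1) - μ (pat 1 (-1) (-1))) / 4, ?_⟩
  intro s
  have hs : s = pat (s a) (s b) (s c) :=
    hext _ _ (hpa _ _ _).symm (hpb _ _ _).symm (hpc _ _ _).symm
  rcases Int.units_eq_one_or (s a) with ha | ha <;>
    rcases Int.units_eq_one_or (s b) with hb | hb <;>
      rcases Int.units_eq_one_or (s c) with hc | hc <;>
        (rw [ha, hb, hc] at hs; rw [hs];
         simp only [hpa, hpb, hpc, hflip, neg_neg, Units.val_one, Units.val_neg, Int.cast_one,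
           Int.cast_neg]; ring)

/-- Functions on `↥{a, b, c}` are determined by their three values. [folklore] -/
theorem l3_subtype_three_ext {α β : Type*} [DecidableEq α] {a b c : α}
    (s t : ↥({a, b, c} : Finset α) → β)
    (ha : s ⟨a, by simp⟩ = t ⟨a, by simp⟩) (hb : s ⟨b, by simp⟩ = t ⟨b, by simp⟩)
    (hc : s ⟨c, by simp⟩ = t ⟨c, by simp⟩) : s = t := by
  funext p
  obtain ⟨z, hz⟩ := p
  simp only [Finset.mem_insert, Finset.mem_singleton] at hz
  rcases hz with rfl | rfl | rfl <;> assumption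

/-- `∑_{p : ↥{a,b,c}} g p = g a + g b + g c` for pairwise distinct `a, b, c`. [folklore] -/
theorem l3_sum_subtype_three {α : Type*} [DecidableEq α] {a b c : α} (hab : a ≠ b) (hac : a ≠ c)
    (hbc : b ≠ c) (g : ↥({a, b, c} : Finset α) → ℝ) :
    ∑ p, g p = g ⟨a, by simp⟩ + g ⟨b, by simp⟩ + g ⟨c, by simp⟩ := by
  set g' : α → ℝ := fun z => if hz : z ∈ ({a, b, c} : Finset α) then g ⟨z, hz⟩ else 0 with hg'
  have h1 : ∀ p : ↥({a, b, c} : Finset α), g p = g' p.1 := fun p => by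
    simp only [hg', dif_pos p.2]
  simp only [h1]
  rw [Finset.sum_coe_sort ({a, b, c} : Finset α) g', Finset.sum_insert (by simp [hab, hac]),
    Finset.sum_insert (by simp [hbc]), Finset.sum_singleton, add_assoc]

/-! ## Registered representative -/

/-- Registered helper `helper_l3_aux` (representative of this auxiliary file): the cylinder moment
identity `∑_s 1_s(ω) φ(s) = φ(ω|_S)` on `Fin n`. [folklore] -/
theorem helper_l3_aux : ∀ (n : ℕ) (S : Finset (Fin n)) (φ : (↥S → ℤˣ) → ℝ) (ω : SpinConfig (Fin n)), ∑ s : ↥S → ℤˣ, (∏ p : ↥S, (1 + (((s p : ℤˣ) : ℤ) : ℝ) * spinAt p.1 ω) / 2) * φ s = φ (fun p : ↥S => ω p.1) :=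
  fun _ S φ ω => l3_sum_cyl_mul S φ ω

end

end Summit.CriticalPhenomena.Ising3DConformalLimit.Cruxes.InverseMFerromagnet.PartialCovarianceLadder
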